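import Mathlib
import Summits.CriticalPhenomena.CardyFormulaZ2.Theorems.CardySelfRefinementGradientComparabilityStubNonAxialShareBulkDrivers
import Summits.CriticalPhenomena.CardyFormulaZ2.Theorems.CardySelfRefinementDefs
import HarnessLib

/-!
# Local surgery around a pivotal axial edge: orientation and admissibility

Helper file for the stub `stub_nonAxialShare_bulk` (D4-bulk) of the line `Sketch` (crux
`stmt-CriticalPhenomena-10269`, `…Theses.CardySelfRefinement.GradientComparability`), continuing
`…BulkDrivers.lean`, now for the edges `edgeOf (v, d)` and the axiality predicate `ax k` of the
self-refinement model (`CardySelfRefinementDefs`):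

* `endpoint_links`: if `σ` does not cross `Q` but `σ ∪ {e}` does (`e` a closed bulk edge), one end
  of `e` is linked in `σ` to `∂₀Q` only and the other to `∂₂Q` only;
* the standard frame `(dirVec d, dirVec (1 - d))` at `v` and the reversed frame at `v + dirVec d`
  (`frame_std`, `frame_rev`), and the admissible (non-axial, `edgeOf`-shaped, within four steps of
  `v`) candidate edges: rails parallel to the axial `e` one row off its coarse line (`adm_rail`,
  `adm_rail_rev`) and posts off the coarse lines across `e` (`adm_post`, `adm_post_rev`);
* **`dispatch`** (registered sub-goal): according to which of the two lines across `e` through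
  its ends is a coarse line (`k ∣ v d`, `k ∣ v d + 1`, or neither — then `k = 3`), run the one-post
  driver in the standard or reversed frame, or the two-post driver, and report the modification in
  coordinates relative to `v`.

No percolation, no named fact.
-/

noncomputable section

namespace Summit.CriticalPhenomena.CardyFormulaZ2.Theorems.CardySelfRefinement

open scoped Topology
open Filter Set MeasureTheory Metric
open Literature.Probability.LatticeModels Literature.Probability.Percolation
open Literature.Probability.Percolation.QuadCrossing
open Summit.CriticalPhenomena.CardyFormulaZ2.Theses.CardySelfRefinement

variable {D : Set ℂ} {δ : ℝ}


/-! ## The two ends of a closed pivotal bulk edge are linked to opposite sides -/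

/-- If `σ` does not cross `Q` but `σ ∪ {x, y}` does, for a closed bulk edge `{x, y}`, then one
end is linked in `σ` to `∂₀Q` only and the other to `∂₂Q` only. -/
theorem endpoint_links (hδ : 0 < δ) (Q : Quad D) {σ : BondConfig (Site 2)} {x y : Site 2}
    (he : s(x, y) ∉ σ)
    (hint : segment ℝ (meshPoint δ x) (meshPoint δ y) ⊆ interior Q.carrier)
    (hσ : ¬ ∃ a ∈ Q.side 0, ∃ b ∈ Q.side 2, JoinedIn (Q.carrier ∩ openEdgeUnion δ σ) a b)
    (hcr : ∃ a ∈ Q.side 0, ∃ b ∈ Q.side 2, JoinedIn (Q.carrier ∩ openEdgeUnion δ (σ ∪ {s(x, y)})) a b) :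
    ((∃ a ∈ Q.side 0, JoinedIn (Q.carrier ∩ openEdgeUnion δ σ) a (meshPoint δ x)) ∧
      (¬ ∃ b ∈ Q.side 2, JoinedIn (Q.carrier ∩ openEdgeUnion δ σ) b (meshPoint δ x)) ∧
      (∃ b ∈ Q.side 2, JoinedIn (Q.carrier ∩ openEdgeUnion δ σ) b (meshPoint δ y)) ∧
      ¬ ∃ a ∈ Q.side 0, JoinedIn (Q.carrier ∩ openEdgeUnion δ σ) a (meshPoint δ y)) ∨
    ((∃ b ∈ Q.side 2, JoinedIn (Q.carrier ∩ openEdgeUnion δ σ) b (meshPoint δ x)) ∧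
      (¬ ∃ a ∈ Q.side 0, JoinedIn (Q.carrier ∩ openEdgeUnion δ σ) a (meshPoint δ x)) ∧
      (∃ a ∈ Q.side 0, JoinedIn (Q.carrier ∩ openEdgeUnion δ σ) a (meshPoint δ y)) ∧
      ¬ ∃ b ∈ Q.side 2, JoinedIn (Q.carrier ∩ openEdgeUnion δ σ) b (meshPoint δ y)) := by
  have hsub : openEdgeUnion δ {s(x, y)} ⊆ interior Q.carrier :=
    (openEdgeUnion_singleton_subset δ x y).trans hint
  have hemp : ∀ z, z ∉ openEdgeUnion δ (∅ : BondConfig (Site 2)) := fun z hz => by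
    obtain ⟨_, _, -, h, -⟩ := mem_openEdgeUnion_iff.1 hz
    exact h
  have hno : ∀ z : ℂ, (∃ a ∈ Q.side 0, JoinedIn (Q.carrier ∩ openEdgeUnion δ σ) a z) →
      ¬ ∃ b ∈ Q.side 2, JoinedIn (Q.carrier ∩ openEdgeUnion δ σ) b z :=
    fun z ⟨a, ha, hJa⟩ ⟨b, hb, hJb⟩ => hσ ⟨a, ha, b, hb, hJa.trans hJb.symm⟩
  have hends : ∀ v, (∃ v', (zdGraph 2).Adj v v' ∧ s(v, v') ∈ ({s(x, y)} : Set _)) → v = x ∨ v = y :=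
    fun v ⟨v', _, hv⟩ => eq_or_eq_of_sym2_eq (Set.mem_singleton_iff.1 hv)
  -- an end linked to `∂₂Q`
  have h2 : ∃ v, (v = x ∨ v = y) ∧ ∃ b ∈ Q.side 2, JoinedIn (Q.carrier ∩ openEdgeUnion δ σ) b (meshPoint δ v) := by
    have hcr' : ∃ a ∈ Q.side 0, ∃ b ∈ Q.side 2,
        JoinedIn (Q.carrier ∩ openEdgeUnion δ (σ ∪ {s(x, y)} ∪ ∅)) a b := by rwa [Set.union_empty]
    rcases crossing_decomposition hδ Q (Sa := {s(x, y)}) (Sb := ∅) (fun e h => by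
        rw [Set.mem_singleton_iff.1 h]; exact he) (fun e h => absurd h (Set.notMem_empty _))
        (fun z _ hz => hemp z hz)
        (fun z hz => by
          rw [Set.union_empty] at hz
          exact ⟨notMem_side_of_mem_interior Q (hsub hz) 0, notMem_side_of_mem_interior Q (hsub hz) 2⟩)
        hcr' with h | ⟨v, hv, hL⟩ | ⟨v, ⟨v', -, hv⟩, -⟩ | ⟨v, v₂, -, ⟨v', -, hv⟩, -⟩
    · exact absurd h hσ
    · exact ⟨v, hends v hv, hL⟩
    · exact absurd hv (Set.notMem_empty _)
    · exact absurd hv (Set.notMem_empty _)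
  -- an end linked to `∂₀Q`
  have h0 : ∃ v, (v = x ∨ v = y) ∧ ∃ a ∈ Q.side 0, JoinedIn (Q.carrier ∩ openEdgeUnion δ σ) a (meshPoint δ v) := by
    have hcr' : ∃ a ∈ Q.side 0, ∃ b ∈ Q.side 2,
        JoinedIn (Q.carrier ∩ openEdgeUnion δ (σ ∪ ∅ ∪ {s(x, y)})) a b := by rwa [Set.union_empty]
    rcases crossing_decomposition hδ Q (Sa := ∅) (Sb := {s(x, y)})
        (fun e h => absurd h (Set.notMem_empty _))
        (fun e h => by rw [Set.mem_singleton_iff.1 h]; exact he) (fun z hz _ => hemp z hz)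
        (fun z hz => by
          rw [Set.empty_union] at hz
          exact ⟨notMem_side_of_mem_interior Q (hsub hz) 0, notMem_side_of_mem_interior Q (hsub hz) 2⟩)
        hcr' with h | ⟨v, ⟨v', -, hv⟩, -⟩ | ⟨v, hv, hL⟩ | ⟨v₂, v, ⟨v', -, hv⟩, -, -⟩
    · exact absurd h hσ
    · exact absurd hv (Set.notMem_empty _)
    · exact ⟨v, hends v hv, hL⟩
    · exact absurd hv (Set.notMem_empty _)
  obtain ⟨v₂, hv₂, hL₂⟩ := h2
  obtain ⟨v₀, hv₀, hL₀⟩ := h0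
  rcases hv₂ with rfl | rfl <;> rcases hv₀ with rfl | rfl
  · exact absurd hL₂ (hno _ hL₀)
  · exact Or.inr ⟨hL₂, hno _ |> fun h h' => h h' hL₂, hL₀, hno _ hL₀⟩
  · exact Or.inl ⟨hL₀, hno _ hL₀, hL₂, fun h' => hno _ h' hL₂⟩
  · exact absurd hL₂ (hno _ hL₀)

/-! ## Admissible (non-axial) edges of the frames -/

/-- The standard frame at `v` along `d`: `u = dirVec d`, `w = dirVec (1 - d)`. -/
theorem frame_std (d : Fin 2) :
    ((dirVec d = ![1, 0] ∨ dirVec d = ![-1, 0]) ∧ (dirVec (1 - d) = ![0, 1] ∨ dirVec (1 - d) = ![0, -1])) ∨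
      ((dirVec d = ![0, 1] ∨ dirVec d = ![0, -1]) ∧ (dirVec (1 - d) = ![1, 0] ∨ dirVec (1 - d) = ![-1, 0])) := by
  fin_cases d
  · exact Or.inl ⟨Or.inl rfl, Or.inl rfl⟩
  · exact Or.inr ⟨Or.inl rfl, Or.inl rfl⟩

/-- The reversed frame at `v + dirVec d`: `u = -dirVec d`, `w = dirVec (1 - d)`. -/
theorem frame_rev (d : Fin 2) :
    ((-dirVec d = ![1, 0] ∨ -dirVec d = ![-1, 0]) ∧ (dirVec (1 - d) = ![0, 1] ∨ dirVec (1 - d) = ![0, -1])) ∨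
      ((-dirVec d = ![0, 1] ∨ -dirVec d = ![0, -1]) ∧ (dirVec (1 - d) = ![1, 0] ∨ dirVec (1 - d) = ![-1, 0])) := by
  fin_cases d
  · refine Or.inl ⟨Or.inr ?_, Or.inl rfl⟩
    ext i; fin_cases i <;> simp [dirVec]
  · refine Or.inr ⟨Or.inr ?_, Or.inl rfl⟩
    ext i; fin_cases i <;> simp [dirVec]

/-- **Rails are admissible.**  In the standard frame `V a b = v + a • dirVec d + b • dirVec (1 - d)`
of an axial `e = edgeOf (v, d)` (`k` divides the coordinate of `v` across `e`), the rail
`{V a t, V (a + 1) t}` (`t = ±1`, parallel to `e` one row off the coarse line) is a non-axial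
edge near `v`. -/
theorem adm_rail {k : ℕ} (hk : k = 2 ∨ k = 3) {v : Site 2} {d : Fin 2} {V : ℤ → ℤ → Site 2}
    (hV : ∀ a b, V a b = v + a • dirVec d + b • dirVec (1 - d))
    (hax : (k : ℤ) ∣ v (if d = 0 then 1 else 0)) {a a' t : ℤ} (haa' : a' = a + 1)
    (ht : t = 1 ∨ t = -1) (ha : |a| ≤ 3) :
    ∃ v' d', s(V a t, V a' t) = edgeOf (v', d') ∧ ¬ ax k (v', d') ∧ ∀ i, |v' i - v i| ≤ 4 := by
  subst haa'
  refine ⟨V a t, d, ?_, ?_, fun i => ?_⟩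
  · rw [hV, hV]
    simp only [edgeOf, add_smul, one_smul]
    congr 1; abel
  · rw [hV]
    simp only [ax]
    rcases hk with rfl | rfl <;> fin_cases d <;> rcases ht with rfl | rfl <;>
      simp [dirVec, Matrix.vecHead, Matrix.vecTail] at hax ⊢ <;> omega
  · have h := frame_coord_le hV (frame_std d) a t i
    have ht1 : |t| = 1 := by rcases ht with rfl | rfl <;> norm_num
    linarith

/-- **Rails are admissible (reversed frame** `V a b = v + dirVec d + a • (-dirVec d) + b • dirVec (1 - d)`,
based at the far end of `e`). -/
theorem adm_rail_rev {k : ℕ} (hk : k = 2 ∨ k = 3) {v : Site 2} {d : Fin 2} {V : ℤ → ℤ → Site 2}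
    (hV : ∀ a b, V a b = v + dirVec d + a • (-dirVec d) + b • dirVec (1 - d))
    (hax : (k : ℤ) ∣ v (if d = 0 then 1 else 0)) {a a' t : ℤ} (haa' : a' = a + 1)
    (ht : t = 1 ∨ t = -1) (ha : |a| ≤ 2) :
    ∃ v' d', s(V a t, V a' t) = edgeOf (v', d') ∧ ¬ ax k (v', d') ∧ ∀ i, |v' i - v i| ≤ 4 := by
  subst haa'
  obtain ⟨v', d', h1, h2, h3⟩ := adm_rail hk (V := fun a b => v + a • dirVec d + b • dirVec (1 - d))
    (fun _ _ => rfl) hax (a := -a) (a' := 1 - a) (by ring) ht (by rw [abs_le] at ha ⊢; omega)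
  refine ⟨v', d', ?_, h2, h3⟩
  rw [← h1, Sym2.eq_swap, hV, hV]
  congr 1 <;> module

/-- **Posts are admissible off the coarse lines** (standard frame): the edge `{V a b, V a (b+1)}`
perpendicular to `e` is non-axial when `k ∤ v d + a`. -/
theorem adm_post {k : ℕ} {v : Site 2} {d : Fin 2} {V : ℤ → ℤ → Site 2}
    (hV : ∀ a b, V a b = v + a • dirVec d + b • dirVec (1 - d)) {a b b' : ℤ} (hbb' : b' = b + 1)
    (hna : ¬ (k : ℤ) ∣ v d + a) (ha : |a| ≤ 3) (hb : |b| ≤ 1) :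
    ∃ v' d', s(V a b, V a b') = edgeOf (v', d') ∧ ¬ ax k (v', d') ∧ ∀ i, |v' i - v i| ≤ 4 := by
  subst hbb'
  refine ⟨V a b, 1 - d, ?_, ?_, fun i => ?_⟩
  · rw [hV, hV]
    simp only [edgeOf, add_smul, one_smul]
    congr 1; abel
  · rw [hV]
    simp only [ax]
    fin_cases d <;> simp [dirVec, Matrix.vecHead, Matrix.vecTail] at hna ⊢ <;> exact hna
  · have h := frame_coord_le hV (frame_std d) a b i
    linarith

/-- **Posts are admissible off the coarse lines (reversed frame).** -/
theorem adm_post_rev {k : ℕ} {v : Site 2} {d : Fin 2} {V : ℤ → ℤ → Site 2}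
    (hV : ∀ a b, V a b = v + dirVec d + a • (-dirVec d) + b • dirVec (1 - d)) {a b b' : ℤ}
    (hbb' : b' = b + 1) (hna : ¬ (k : ℤ) ∣ v d + (1 - a)) (ha : |a| ≤ 2) (hb : |b| ≤ 1) :
    ∃ v' d', s(V a b, V a b') = edgeOf (v', d') ∧ ¬ ax k (v', d') ∧ ∀ i, |v' i - v i| ≤ 4 := by
  subst hbb'
  obtain ⟨v', d', h1, h2, h3⟩ := adm_post (V := fun a b => v + a • dirVec d + b • dirVec (1 - d))
    (fun _ _ => rfl) (a := 1 - a) (b := b) rfl hna (by rw [abs_le] at ha ⊢; omega) hb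
  refine ⟨v', d', ?_, h2, h3⟩
  rw [← h1, hV, hV]
  congr 1 <;> module

/-! ## Dispatch on the position of the coarse lines -/

/-- Coordinates of the far end of `e` differ from those of `v` by at most one. -/
theorem abs_add_dirVec_sub_le (v : Site 2) (d i : Fin 2) : |(v + dirVec d) i - v i| ≤ 1 := by
  fin_cases d <;> fin_cases i <;> simp [dirVec]

/-- **Dispatch.**  For an axial closed bulk edge `e = {v, v + dirVec d}` whose end `v` is linked
(in the non-crossing `σ`) to `∂_{jp}Q` only and whose far end to `∂_{jq}Q` only, some NON-AXIAL
edge `e'` within four lattice steps of `v` is pivotal for the crossing of `Q` after a local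
modification `σ ↦ (σ ∖ Rm) ∪ S` by genuine edges within four steps of `v`: `S ∖ {e'}` added to
`σ ∖ Rm` does not cross, while `S` reconnects all ends of `Rm ∋ e` through a connected drawing
(so that every quad crossed by `σ ∪ {e}` stays crossed, `crossing_reroute`).  According to which
of the two lines across `e` through its ends is a coarse line, the one-post driver is run in the
standard or in the reversed frame, or the two-post driver in the standard frame. -/
theorem dispatch {D : Set ℂ} {δ : ℝ} {k : ℕ} (hk : k = 2 ∨ k = 3) (hδ : 0 < δ) (Q : Quad D) {σ : BondConfig (Site 2)}
    {jp jq : Fin 4} (hj : (jp = 0 ∧ jq = 2) ∨ (jp = 2 ∧ jq = 0))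
    (hσ : ¬ ∃ a ∈ Q.side 0, ∃ b ∈ Q.side 2, JoinedIn (Q.carrier ∩ openEdgeUnion δ σ) a b)
    {v : Site 2} {d : Fin 2} (hax : (k : ℤ) ∣ v (if d = 0 then 1 else 0))
    (hballv : Metric.closedBall (meshPoint δ v) (4 * δ) ⊆ interior Q.carrier)
    (hbally : Metric.closedBall (meshPoint δ (v + dirVec d)) (4 * δ) ⊆ interior Q.carrier)
    (he : s(v, v + dirVec d) ∉ σ)
    (hvP : ∃ a ∈ Q.side jp, JoinedIn (Q.carrier ∩ openEdgeUnion δ σ) a (meshPoint δ (v))) (hvQ : ¬ ∃ a ∈ Q.side jq, JoinedIn (Q.carrier ∩ openEdgeUnion δ σ) a (meshPoint δ (v))) (hyQ : ∃ a ∈ Q.side jq, JoinedIn (Q.carrier ∩ openEdgeUnion δ σ) a (meshPoint δ (v + dirVec d))) (hyP : ¬ ∃ a ∈ Q.side jp, JoinedIn (Q.carrier ∩ openEdgeUnion δ σ) a (meshPoint δ (v + dirVec d))) :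
    ∃ (Rm S : Set (Sym2 (Site 2))) (e' : Sym2 (Site 2)), s(v, v + dirVec d) ∈ Rm ∧ e' ∈ S ∧
      (∃ v' d', e' = edgeOf (v', d') ∧ ¬ ax k (v', d') ∧ ∀ i, |v' i - v i| ≤ 4) ∧
      (∀ r ∈ Rm ∪ S, ∃ x y, r = s(x, y) ∧ (zdGraph 2).Adj x y ∧
        ∀ i, |x i - v i| ≤ 4 ∧ |y i - v i| ≤ 4) ∧
      IsPreconnected (openEdgeUnion δ S) ∧ (∀ r ∈ Rm, ∀ x ∈ r, meshPoint δ x ∈ openEdgeUnion δ S) ∧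
      ¬ ∃ a ∈ Q.side 0, ∃ b ∈ Q.side 2,
        JoinedIn (Q.carrier ∩ openEdgeUnion δ (σ \ Rm ∪ (S \ {e'}))) a b := by
  have hj' : (jq = 0 ∧ jp = 2) ∨ (jq = 2 ∧ jp = 0) := by
    rcases hj with ⟨h1, h2⟩ | ⟨h1, h2⟩
    exacts [Or.inr ⟨h2, h1⟩, Or.inl ⟨h2, h1⟩]
  by_cases hB : (k : ℤ) ∣ v d
  · -- the line across `e` through `v` is coarse: one-post driver, standard frame
    obtain ⟨V, hV⟩ : ∃ V : ℤ → ℤ → Site 2, ∀ a b, V a b = v + a • dirVec d + b • dirVec (1 - d) :=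
      ⟨_, fun _ _ => rfl⟩
    have h00 : V 0 0 = v := by rw [hV]; simp
    have h10 : V 1 0 = v + dirVec d := by rw [hV]; simp
    have hn1 : ¬ (k : ℤ) ∣ v d + 1 := by rcases hk with rfl | rfl <;> push_cast at hB ⊢ <;> omega
    have hn2 : ¬ (k : ℤ) ∣ v d + -1 := by rcases hk with rfl | rfl <;> push_cast at hB ⊢ <;> omega
    obtain ⟨Rm, S, e', h1, h2, h3, h4, h5, h6, h7⟩ := driver_onePost hδ Q hj hσ hV (frame_std d) hballv
      (by rw [h00, h10]; exact he) (by rw [h00]; exact hvP) (by rw [h00]; exact hvQ)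
      (by rw [h10]; exact hyQ) (by rw [h10]; exact hyP)
      (Adm := fun r => ∃ v' d', r = edgeOf (v', d') ∧ ¬ ax k (v', d') ∧ ∀ i, |v' i - v i| ≤ 4)
      (adm_rail hk hV hax (a := 0) (by norm_num) (Or.inl rfl) (by norm_num))
      (adm_rail hk hV hax (a := 0) (by norm_num) (Or.inr rfl) (by norm_num))
      (adm_post hV (a := 1) (b := 0) (by norm_num) hn1 (by norm_num) (by norm_num))
      (by rw [Sym2.eq_swap]; exact adm_post hV (a := 1) (b := -1) (by norm_num) hn1 (by norm_num) (by norm_num))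
      (adm_post hV (a := -1) (b := 0) (by norm_num) hn2 (by norm_num) (by norm_num))
      (adm_rail hk hV hax (a := -1) (by norm_num) (Or.inl rfl) (by norm_num))
    refine ⟨Rm, S, e', by rw [h00, h10] at h1; exact h1, h2, h3, fun r hr => ?_, h5, h6, h7⟩
    obtain ⟨x, y, hxy, hadj, hnear⟩ := h4 r hr
    exact ⟨x, y, hxy, hadj, fun i => ⟨(hnear i).1.trans (by norm_num), (hnear i).2.trans (by norm_num)⟩⟩
  by_cases hC : (k : ℤ) ∣ v d + 1
  · -- the line through the far end is coarse: one-post driver, reversed frame (ends exchanged)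
    obtain ⟨V, hV⟩ : ∃ V : ℤ → ℤ → Site 2, ∀ a b, V a b = v + dirVec d + a • (-dirVec d) + b • dirVec (1 - d) :=
      ⟨_, fun _ _ => rfl⟩
    have h00 : V 0 0 = v + dirVec d := by rw [hV]; simp
    have h10 : V 1 0 = v := by rw [hV]; simp
    have hn0 : ¬ (k : ℤ) ∣ v d + (1 - 1) := by norm_num; exact hB
    have hn2 : ¬ (k : ℤ) ∣ v d + (1 - (-1)) := by
      rcases hk with rfl | rfl <;> push_cast at hC ⊢ <;> omega
    obtain ⟨Rm, S, e', h1, h2, h3, h4, h5, h6, h7⟩ := driver_onePost hδ Q hj' hσ hV (frame_rev d) hbally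
      (by rw [h00, h10, Sym2.eq_swap]; exact he) (by rw [h00]; exact hyQ) (by rw [h00]; exact hyP)
      (by rw [h10]; exact hvP) (by rw [h10]; exact hvQ)
      (Adm := fun r => ∃ v' d', r = edgeOf (v', d') ∧ ¬ ax k (v', d') ∧ ∀ i, |v' i - v i| ≤ 4)
      (adm_rail_rev hk hV hax (a := 0) (by norm_num) (Or.inl rfl) (by norm_num))
      (adm_rail_rev hk hV hax (a := 0) (by norm_num) (Or.inr rfl) (by norm_num))
      (adm_post_rev hV (a := 1) (b := 0) (by norm_num) hn0 (by norm_num) (by norm_num))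
      (by rw [Sym2.eq_swap]; exact adm_post_rev hV (a := 1) (b := -1) (by norm_num) hn0 (by norm_num) (by norm_num))
      (adm_post_rev hV (a := -1) (b := 0) (by norm_num) hn2 (by norm_num) (by norm_num))
      (adm_rail_rev hk hV hax (a := -1) (by norm_num) (Or.inl rfl) (by norm_num))
    refine ⟨Rm, S, e', ?_, h2, h3, fun r hr => ?_, h5, h6, h7⟩
    · rw [h00, h10, Sym2.eq_swap] at h1; exact h1
    · obtain ⟨x, y, hxy, hadj, hnear⟩ := h4 r hr
      refine ⟨x, y, hxy, hadj, fun i => ⟨?_, ?_⟩⟩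
      · have := abs_sub_le (x i) ((v + dirVec d) i) (v i)
        linarith [(hnear i).1, abs_add_dirVec_sub_le v d i]
      · have := abs_sub_le (y i) ((v + dirVec d) i) (v i)
        linarith [(hnear i).2, abs_add_dirVec_sub_le v d i]
  · -- neither line is coarse (`k = 3`): two-post driver, standard frame
    obtain ⟨V, hV⟩ : ∃ V : ℤ → ℤ → Site 2, ∀ a b, V a b = v + a • dirVec d + b • dirVec (1 - d) :=
      ⟨_, fun _ _ => rfl⟩
    have h00 : V 0 0 = v := by rw [hV]; simp
    have h10 : V 1 0 = v + dirVec d := by rw [hV]; simp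
    have hn0 : ¬ (k : ℤ) ∣ v d + 0 := by rw [add_zero]; exact hB
    have hn2 : ¬ (k : ℤ) ∣ v d + -2 := by
      rcases hk with rfl | rfl <;> push_cast at hB hC ⊢ <;> omega
    obtain ⟨Rm, S, e', h1, h2, h3, h4, h5, h6, h7⟩ := driver_twoPost hδ Q hj hσ hV (frame_std d) hballv
      (by rw [h00, h10]; exact he) (by rw [h00]; exact hvP) (by rw [h00]; exact hvQ)
      (by rw [h10]; exact hyQ) (by rw [h10]; exact hyP)
      (Adm := fun r => ∃ v' d', r = edgeOf (v', d') ∧ ¬ ax k (v', d') ∧ ∀ i, |v' i - v i| ≤ 4)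
      (adm_rail hk hV hax (a := 0) (by norm_num) (Or.inl rfl) (by norm_num))
      (adm_rail hk hV hax (a := 0) (by norm_num) (Or.inr rfl) (by norm_num))
      (adm_post hV (a := 1) (b := 0) (by norm_num) hC (by norm_num) (by norm_num))
      (by rw [Sym2.eq_swap]; exact adm_post hV (a := 1) (b := -1) (by norm_num) hC (by norm_num) (by norm_num))
      (adm_post hV (a := 0) (b := 0) (by norm_num) hn0 (by norm_num) (by norm_num))
      (by rw [Sym2.eq_swap]; exact adm_post hV (a := 0) (b := -1) (by norm_num) hn0 (by norm_num) (by norm_num))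
      (adm_rail hk hV hax (a := -1) (by norm_num) (Or.inl rfl) (by norm_num))
      (adm_rail hk hV hax (a := -1) (by norm_num) (Or.inr rfl) (by norm_num))
      (adm_post hV (a := -2) (b := 0) (by norm_num) hn2 (by norm_num) (by norm_num))
      (adm_rail hk hV hax (a := -2) (by norm_num) (Or.inl rfl) (by norm_num))
    refine ⟨Rm, S, e', by rw [h00, h10] at h1; exact h1, h2, h3, fun r hr => ?_, h5, h6, h7⟩
    obtain ⟨x, y, hxy, hadj, hnear⟩ := h4 r hr
    exact ⟨x, y, hxy, hadj, fun i => ⟨(hnear i).1.trans (by norm_num), (hnear i).2.trans (by norm_num)⟩⟩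

end Summit.CriticalPhenomena.CardyFormulaZ2.Theorems.CardySelfRefinement

end
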